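import Mathlib
import Summits.Ventures.FusionMHD.Models.CerfonFreidbergIterLikeQHalfShearDefs
import HarnessLib

/-!
# Ventures/FusionMHD — Models/CerfonFreidbergIterLikeQHalfShearPanels13.lean: KERNEL CHECK of the shear-register certificates of panels 24, 25 (of 32)
# at `ψ_N = 1/2` of THE Cerfon–Freidberg ITER-like instance

HONEST FRAMING (LADDER-GRIDFUSION three columns; CF rung; successor step of «q′(ψ_N = 1/2) on the CF rung», F2-SCOPING v1.6 §10(c)).  One `decide +kernel`
(≈ 80 s): for each listed panel the obligation `CFIterLike.QHalfShear.ShearCert.ok` (`Models/CerfonFreidbergIterLikeQHalfShearDefs.lean`) — the Taylor-model run of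
`progQ = CFIterLike.QHalf.progA ++ blockQ` over ★ #117's parameter box is ACCEPTED and the kernel's panel-integral enclosure of the shear kernel `K·p` along the
approximant lies inside the claimed integers (read off a compiled `#eval` of the same functions, slack one unit of `2⁻⁶⁰`; float truth inside every panel).
MODELLED: analytic Cerfon–Freidberg family; nothing about a device or stability.  No `native_decide`.  Typer/prover: gridfusion-model-5 (g8), 2026-08-27.
Citations: Freidberg 2014 §6.3.5 (6.35) [Freidberg2014]; Mahboubi–Melquiond–Sibut-Pinote 2016 §3.2 Lemma 3 [MahboubiMelquiondSibutpinote2016].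
-/

namespace Summit.Ventures.FusionMHD.Models.CFIterLike.QHalfShear

/-- Shear-register certificate data of panels 24, 25. [instance data] -/
def shearCert13 : List ShearCert := [
  { j := 24, cand := [1463646959398530318336, -7755099614427718090752, 27286920670344118272000, 20821693097346288582656, -807559625373298318114816, 5491198354573334316843008, -20288189112968847118303232, 15154677928072650071998464, 379184759197883391218286592, -3145721365307438584121262080, 12639121353689281366465708032, 6359380090332347689563324416, 1245521228079358214858742956032],
    deg := 10, elog2 := 45, plo := 9932484649172109784, phi := 9932485251842700475 },
  { j := 25, cand := [1247958222408858992640, -6064523789309664296960, 25909319139113138388992, -37944155204078247346176, -214610290263967433490432, 2360107064167544871976960, -12288638865522719297896448, 40788352835454269942398976, -48580553183549356593119232, -414756394087494327417700352, 3353866776962594597767217152, -53086948918853663684913266688, 842424363666913693226932109312],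
    deg := 10, elog2 := 44, plo := 8625789719325127671, phi := 8625790059007079276 }]

/-- **KERNEL CHECK** of the shear register on panels 24, 25. -/
theorem shearCert13_ok : CFIterLike.QHalfShear.shearCert13.all ShearCert.ok = true := by
  decide +kernel

end Summit.Ventures.FusionMHD.Models.CFIterLike.QHalfShear
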